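import Literature.Analysis.FluidPDE.JetStressAlgebra
import Literature.Analysis.FluidPDE.TorusForceBookkeeping
import Literature.Analysis.FluidPDE.NSRPerturbationVisc
import Mathlib.Tactic.Module
import HarnessLib

/-!
# Luo–Titi's perturbation: the intermittent-jet perturbation with a temporal cut-off
  (Luo–Titi 2020, §3.3–§3.5; Buckmaster–Vicol 2019 survey, §7.5–§7.6)

Analysis/FluidPDE support file (everything proved; no named facts) for the proof of the Iteration
Lemma of T. Luo and E. S. Titi, Calc. Var. PDE 59 (2020) = arXiv:1808.07595
(`Torus.LuoTiti2020_iterationLemma`, `FluidPDE/FractionalNSReynolds`). §3.3 of the paper builds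
the velocity increment `w_{q+1} = w^{(p)} + w^{(c)} + w^{(t)}` from amplitudes
`a_(ξ) = ρ^{1/2} γ_(ξ)(Id - ρ⁻¹R_q)` with `ρ(t,x) = ε_γ⁻¹ δ_{q+1} χ(δ_{q+1}⁻¹|R_q|) ψ²(t)`, where
"`ψ(t)` [is] a smooth cut-off function such that `ψ = 1` on `supp_t R_q`, `supp ψ ⊂ N_{δ_{q+1}}(supp_t R_q)`"
— so that `w^{(p)}, w^{(c)}` carry one factor `ψ` and the temporal corrector `w^{(t)}` (quadratic
in the amplitudes) carries `ψ²`, and "`supp_t w_{q+1} ⊂ supp_t ρ ⊂ supp ψ`" ((3.13)); §3.5 then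
computes the new stress. This file realises exactly this structure ON TOP OF the tree's
intermittent-jet step (`FluidPDE/JetPerturbation`, `JetStressAlgebra`: the datum `D` carries the
stress `M := R_q` restricted to a slab `[0, T]`, the algebraic amplitude floor `γ₀`, and the jet
parameters; `D.wpc = w^{(p)} + w^{(c)}`, `D.X + ∇D.zeta = w^{(t)}`), with a temporal cut-off
`ψ ∈ C_c^∞((0, T))`, `ψ = 1` wherever `R_q ≠ 0`:

* `LuoTiti.Setup` / `Setup.Valid` — the data; `Setup.w = ψ•wpc + ψ²•(X + ∇ζ)` on ALL of `ℝ × 𝕋³`,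
  its local part `Setup.wloc = ψ•wpc + ψ²•X`, the stress `Setup.Sψ`, the pressure `Setup.qψ` and
  the source `Setup.fψ` of the identity below;
* joint smoothness on `ℝ × 𝕋³` (`isSmoothSpaceTimeOn_univ_cutoff`: a slab-smooth field times a
  smooth time factor supported inside the open slab is smooth on the whole line), `div w = 0`,
  `∫ w = 0`, the temporal support `supp_t ⊆ tsupport ψ` of everything, and the time derivative
  `∂ₜw = ψ′wpc + ψ∂ₜwpc + 2ψψ′wt + ψ²∂ₜwt` inside the slab (`Setup.timeDeriv_w_of_mem`).

The data `Sψ, qψ, fψ` are those of the Reynolds-stress identity of the perturbation,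
`∂ₜw + div(w ⊗ w) + div R = div S_ψ + ∇q_ψ + f_ψ`, obtained from the jet identity `(⋆)`
(`JetStep.Datum.star`, with the carried stress `Rc = (tr R/3) Id`, so that `Rc + R̊ = R` and
`div Rc = ∇(tr R/3)` is a pressure) multiplied by `ψ²`: since `R = 0` wherever `ψ ≠ 1`, the
difference `(ours) - ψ²·(⋆)` consists only of the small terms `ψ′ wpc`, `(ψ-ψ²)∂ₜwpc`, `2ψψ′X`
(sources), `(ψ³-ψ²)(wpc ⊗ wt + wt ⊗ wpc) + (ψ⁴-ψ²) wt ⊗ wt` (stress) and gradients. The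
identity itself and `∫ f_ψ = 0` are proved in the sibling `LuoTitiPerturbationIdentity`.

## References

* T. Luo, E. S. Titi, Calc. Var. PDE 59 (2020) = arXiv:1808.07595, §3.3 (the cut-off `ψ`, `ρ`,
  `a_(ξ)`, `w = w^{(p)} + w^{(c)} + w^{(t)}`), (3.13), §3.5 (the display defining `R_{q+1}`).
  [`LuoTiti2020`]
* T. Buckmaster, V. Vicol, EMS Surv. Math. Sci. 6 (2019) = arXiv:1901.09023, §7.5–§7.6.
  [`BuckmasterVicol2020`]
-/

noncomputable section

open MeasureTheory Set Filter Topology Function UnitAddTorus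
open scoped InnerProductSpace ContDiff ENNReal

namespace Literature.Analysis.FluidPDE

/-! ## Slab-smooth fields times compactly supported time factors -/

namespace Torus

open Literature.Analysis.FunctionSpaces FunctionSpaces.Torus

variable {d : Type*} [Fintype d]
variable {F : Type*} [NormedAddCommGroup F] [NormedSpace ℝ F]

/-- **A slab-smooth field times a smooth time factor supported inside the open slab is smooth on
the whole line**: if `U` is jointly smooth on `[0, T] × 𝕋^d`, `φ ∈ C^∞(ℝ)` and
`tsupport φ ⊆ (0, T)`, then `(t, y) ↦ φ(t) U(t, y)` is jointly smooth on `ℝ × 𝕋^d` (near `(0,T)`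
a product of smooth functions, near the complement of `tsupport φ` identically zero).
[cite: LuoTiti2020, §3.3 (3.13)] -/
theorem isSmoothSpaceTimeOn_univ_cutoff {T : ℝ} {U : ℝ → UnitAddTorus d → F}
    (hU : Torus.IsSmoothSpaceTimeOn (Icc 0 T) U) {φ : ℝ → ℝ} (hφ : ContDiff ℝ ∞ φ) (hsupp : tsupport φ ⊆ Ioo 0 T) :
    Torus.IsSmoothSpaceTimeOn univ (fun t y => φ t • U t y) := by
  unfold FunctionSpaces.Torus.IsSmoothSpaceTimeOn
  rw [univ_prod_univ]
  refine (contDiff_iff_contDiffAt.2 fun z => ?_).contDiffOn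
  obtain ⟨t₀, Y⟩ := z
  have e : stLift (fun t y => φ t • U t y) = fun q : ℝ × EuclideanSpace ℝ d => φ q.1 • stLift U q := by
    funext q; rfl
  rw [e]
  by_cases hz : t₀ ∈ tsupport φ
  · -- inside the open slab: a product of smooth functions
    have hzI : t₀ ∈ Ioo 0 T := hsupp hz
    have hmem : (Icc 0 T ×ˢ (univ : Set (EuclideanSpace ℝ d))) ∈ 𝓝 (t₀, Y) :=
      prod_mem_nhds (mem_of_superset (Ioo_mem_nhds hzI.1 hzI.2) Ioo_subset_Icc_self) univ_mem
    have h1 : ContDiffAt ℝ ∞ (stLift U) (t₀, Y) := hU.contDiffAt hmem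
    exact ((hφ.comp contDiff_fst).contDiffAt).smul h1
  · -- outside the support: identically zero nearby
    have hopen : IsOpen ((tsupport φ)ᶜ ×ˢ (univ : Set (EuclideanSpace ℝ d))) :=
      (isClosed_tsupport φ).isOpen_compl.prod isOpen_univ
    have hzmem : (t₀, Y) ∈ (tsupport φ)ᶜ ×ˢ (univ : Set (EuclideanSpace ℝ d)) := ⟨hz, mem_univ _⟩
    have hev : (fun q : ℝ × EuclideanSpace ℝ d => φ q.1 • stLift U q) =ᶠ[𝓝 (t₀, Y)] fun _ => 0 := by
      filter_upwards [hopen.mem_nhds hzmem] with q hq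
      rw [image_eq_zero_of_notMem_tsupport hq.1, zero_smul]
    exact (contDiffAt_const (c := (0 : F))).congr_of_eventuallyEq hev

/-- The time derivative of `φ U` inside the open slab: `∂ₜ(φU) = φ′U + φ ∂ₜU` with the slab
derivative `∂ₜU = timeDerivWithin [0,T] U` (interior point). [folklore] -/
theorem hasDerivAt_cutoff_of_mem {T : ℝ} {U : ℝ → UnitAddTorus d → F} (hU : Torus.IsSmoothSpaceTimeOn (Icc 0 T) U)
    {φ : ℝ → ℝ} (hφ : ContDiff ℝ ∞ φ) {t : ℝ} (ht : t ∈ Ioo 0 T) (y : UnitAddTorus d) :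
    HasDerivAt (fun s => φ s • U s y) (deriv φ t • U t y + φ t • Torus.timeDerivWithin (Icc 0 T) U t y) t := by
  have hU' : HasDerivAt (fun s => U s y) (Torus.timeDerivWithin (Icc 0 T) U t y) t :=
    (hU.hasDerivWithinAt_slice (Ioo_subset_Icc_self ht) y).hasDerivAt (Icc_mem_nhds ht.1 ht.2)
  have hφ' : HasDerivAt φ (deriv φ t) t := (hφ.differentiable (by simp)).differentiableAt.hasDerivAt
  have h : HasDerivAt (fun s => φ s • U s y) (φ t • Torus.timeDerivWithin (Icc 0 T) U t y + deriv φ t • U t y) t :=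
    hφ'.smul hU'
  rw [add_comm] at h
  exact h

/-- `deriv` form of `hasDerivAt_cutoff_of_mem`. [folklore] -/
theorem timeDeriv_cutoff_of_mem {T : ℝ} {U : ℝ → UnitAddTorus d → F} (hU : Torus.IsSmoothSpaceTimeOn (Icc 0 T) U)
    {φ : ℝ → ℝ} (hφ : ContDiff ℝ ∞ φ) {t : ℝ} (ht : t ∈ Ioo 0 T) (y : UnitAddTorus d) :
    Torus.timeDeriv (fun t y => φ t • U t y) t y = deriv φ t • U t y + φ t • Torus.timeDerivWithin (Icc 0 T) U t y :=
  (hasDerivAt_cutoff_of_mem hU hφ ht y).deriv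

omit [Fintype d] in
/-- Outside the support of the time factor the field `φ U` and its time derivative vanish. [folklore] -/
theorem timeDeriv_cutoff_of_not_mem {U : ℝ → UnitAddTorus d → F} {φ : ℝ → ℝ} {t : ℝ} (ht : t ∉ tsupport φ)
    (y : UnitAddTorus d) : Torus.timeDeriv (fun t y => φ t • U t y) t y = 0 := by
  have hev : (fun s => φ s • U s y) =ᶠ[𝓝 t] fun _ => 0 := by
    filter_upwards [(isClosed_tsupport φ).isOpen_compl.mem_nhds ht] with s hs
    rw [image_eq_zero_of_notMem_tsupport hs, zero_smul]
  unfold Torus.timeDeriv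
  rw [hev.deriv_eq, deriv_const]

omit [Fintype d] [NormedSpace ℝ F] in
/-- `φ(t) = 0` off `tsupport φ`. [folklore] -/
theorem apply_eq_zero_of_not_mem_tsupport {φ : ℝ → ℝ} {t : ℝ} (ht : t ∉ tsupport φ) : φ t = 0 :=
  image_eq_zero_of_notMem_tsupport ht

omit [Fintype d] [NormedSpace ℝ F] in
/-- `φ′(t) = 0` off `tsupport φ`. [folklore] -/
theorem deriv_eq_zero_of_not_mem_tsupport {φ : ℝ → ℝ} {t : ℝ} (ht : t ∉ tsupport φ) : deriv φ t = 0 :=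
  image_eq_zero_of_notMem_tsupport fun h => ht (tsupport_deriv_subset h)

end Torus

/-! ## The set-up: a jet datum and a temporal cut-off -/

namespace LuoTiti

open Literature.Analysis.FunctionSpaces FunctionSpaces.Torus Mikado NashGeometric Jet JetStep

/-- Notation: the three-torus and its tangent space. -/
local notation "𝕋³" => UnitAddTorus (Fin 3)
local notation "E³" => EuclideanSpace ℝ (Fin 3)

/-- **The data of Luo–Titi's perturbation**: an intermittent-jet datum `D` (whose stress `D.M` is
the Reynolds stress `R_q` to be cancelled, on the slab `[0, D.T]`) and a temporal cut-off `ψ`.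
[cite: LuoTiti2020, §3.3] -/
structure Setup where
  /-- the jet datum (`M = R_q`, floor `γ₀`, parameters `μ, κ, σ, μ′`, bump `g`) -/
  D : JetStep.Datum
  /-- the temporal cut-off -/
  ψ : ℝ → ℝ

namespace Setup

variable (S : Setup)

/-- **Admissibility**: a valid jet datum; `ψ` smooth with values in `[0, 1]`, compactly supported in
the open slab `(0, T)`, and `ψ = 1` wherever the stress is non-zero ("`ψ(t) = 1` on `supp_t R_q`").
[cite: LuoTiti2020, §3.3 (the display before (3.9))] -/
structure Valid : Prop where
  hD : S.D.Valid
  hψ : ContDiff ℝ ∞ S.ψ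
  hψ01 : ∀ t, 0 ≤ S.ψ t ∧ S.ψ t ≤ 1
  hψsupp : tsupport S.ψ ⊆ Ioo 0 S.D.T
  hψM : ∀ t, S.ψ t = 1 ∨ S.D.M t = 0

/-- The temporal corrector `w^{(t)} = X + ∇ζ` of the jet step. [cite: BuckmasterVicol2020, §7.5.3 (7.37)] -/
def wt (D : JetStep.Datum) (t : ℝ) (y : 𝕋³) : E³ := D.X t y + Torus.gradient (D.zeta t) y

/-- **The perturbation** `w = ψ (w^{(p)} + w^{(c)}) + ψ² w^{(t)}` on `ℝ × 𝕋³`. [cite: LuoTiti2020, §3.3] -/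
def w (t : ℝ) (y : 𝕋³) : E³ := S.ψ t • S.D.wpc t y + (S.ψ t) ^ 2 • wt S.D t y

/-- The local part `ψ (w^{(p)} + w^{(c)}) + ψ² X` of the perturbation (`w = wloc + ∇(ψ²ζ)`). [folklore] -/
def wloc (t : ℝ) (y : 𝕋³) : E³ := S.ψ t • S.D.wpc t y + (S.ψ t) ^ 2 • S.D.X t y

/-- The gradient potential `ψ² ζ` of the perturbation. [folklore] -/
def Z (t : ℝ) (y : 𝕋³) : ℝ := (S.ψ t) ^ 2 * S.D.zeta t y

/-- The carried stress `(tr R/3) Id`, so that `Rc + R̊ = R`. [folklore] -/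
def Rc (D : JetStep.Datum) (t : ℝ) (y : 𝕋³) (j : Fin 3) : E³ := (Torus.tensorTrace (D.M t) y / 3) • EuclideanSpace.single j (1 : ℝ)

/-- **The stress of the identity**:
`S_ψ = ψ²(cross + S_osc) + (ψ³-ψ²)(wpc ⊗ wt + wt ⊗ wpc) + (ψ⁴-ψ²) wt ⊗ wt`. [cite: LuoTiti2020, §3.5] -/
def Sψ (t : ℝ) (y : 𝕋³) (j : Fin 3) : E³ :=
  (S.ψ t) ^ 2 • (S.D.cross t y j + S.D.Sosc t y j) +
    ((S.ψ t) ^ 3 - (S.ψ t) ^ 2) • (Torus.tensorProd (S.D.wpc t) (wt S.D t) y j + Torus.tensorProd (wt S.D t) (S.D.wpc t) y j) +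
    ((S.ψ t) ^ 4 - (S.ψ t) ^ 2) • Torus.tensorProd (wt S.D t) (wt S.D t) y j

/-- **The pressure of the identity**: `q_ψ = ψ²(q + tr R/3) + 2ψψ′ζ`. [folklore] -/
def qψ (t : ℝ) (y : 𝕋³) : ℝ := (S.ψ t) ^ 2 * (S.D.qfun t y + Torus.tensorTrace (S.D.M t) y / 3) + 2 * S.ψ t * deriv S.ψ t * S.D.zeta t y

/-- **The source of the identity** (inverted by `ℛ` in the new stress):
`f_ψ = ψ² f + ψ′ wpc + (ψ - ψ²) ∂ₜwpc + 2ψψ′ X`. [cite: LuoTiti2020, §3.5] -/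
def fψ (t : ℝ) (y : 𝕋³) : E³ :=
  (S.ψ t) ^ 2 • S.D.ffun t y + deriv S.ψ t • S.D.wpc t y +
    (S.ψ t - (S.ψ t) ^ 2) • Torus.timeDerivWithin (Icc 0 S.D.T) S.D.wpc t y + (2 * S.ψ t * deriv S.ψ t) • S.D.X t y

variable {S} (h : S.Valid)
include h

/-! ### Time factors -/

/-- `tsupport ψ ⊆ [0, T]`. [folklore] -/
theorem tsupport_subset_Icc : tsupport S.ψ ⊆ Icc 0 S.D.T := h.hψsupp.trans Ioo_subset_Icc_self

/-- Powers and products of the cut-off are smooth with support in `tsupport ψ`. [folklore] -/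
theorem timeFactor_pow (n : ℕ) (hn : n ≠ 0) : ContDiff ℝ ∞ (fun t => (S.ψ t) ^ n) ∧ tsupport (fun t => (S.ψ t) ^ n) ⊆ Ioo 0 S.D.T := by
  refine ⟨h.hψ.pow n, (closure_mono ?_).trans ((isClosed_tsupport S.ψ).closure_subset_iff.2 subset_rfl |>.trans h.hψsupp)⟩
  intro t ht
  exact subset_tsupport _ (by simpa [Function.mem_support, pow_eq_zero_iff hn] using ht)

/-- `ψ^m - ψ^n` (with `m, n ≥ 1`). [folklore] -/
theorem timeFactor_pow_sub_pow (m n : ℕ) (hm : m ≠ 0) (hn : n ≠ 0) :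
    ContDiff ℝ ∞ (fun t => (S.ψ t) ^ m - (S.ψ t) ^ n) ∧ tsupport (fun t => (S.ψ t) ^ m - (S.ψ t) ^ n) ⊆ Ioo 0 S.D.T := by
  refine ⟨(h.hψ.pow m).sub (h.hψ.pow n), (closure_mono ?_).trans ((isClosed_tsupport S.ψ).closure_subset_iff.2 subset_rfl |>.trans h.hψsupp)⟩
  intro t ht
  refine subset_tsupport _ (Function.mem_support.2 fun h0 => ht ?_)
  simp [h0, zero_pow hm, zero_pow hn]

/-- `ψ′` and `2ψψ′`. [folklore] -/
theorem timeFactor_deriv : (ContDiff ℝ ∞ (deriv S.ψ) ∧ tsupport (deriv S.ψ) ⊆ Ioo 0 S.D.T) ∧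
    (ContDiff ℝ ∞ (fun t => 2 * S.ψ t * deriv S.ψ t) ∧ tsupport (fun t => 2 * S.ψ t * deriv S.ψ t) ⊆ Ioo 0 S.D.T) := by
  have hd : ContDiff ℝ ∞ (deriv S.ψ) := h.hψ.deriv'
  refine ⟨⟨hd, tsupport_deriv_subset.trans h.hψsupp⟩, (contDiff_const.mul h.hψ).mul hd, ?_⟩
  exact (tsupport_mul_subset_right (f := fun t => 2 * S.ψ t) (g := deriv S.ψ)).trans (tsupport_deriv_subset.trans h.hψsupp)

/-! ### Smoothness on `ℝ × 𝕋³` -/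

/-- The temporal corrector is smooth on the slab. [folklore] -/
theorem smooth_wt : Torus.IsSmoothSpaceTimeOn (Icc 0 S.D.T) (wt S.D) :=
  (Datum.smooth_X h.hD).add ((Datum.smooth_zeta h.hD).gradient (Datum.uniqueDiffOn h.hD))

omit h in
/-- `w_D = wpc + wt`. [folklore] -/
theorem w_D_eq (D : JetStep.Datum) (t : ℝ) (y : 𝕋³) : D.w t y = D.wpc t y + wt D t y := by
  show D.w' t y + Torus.gradient (D.zeta t) y = D.wpc t y + (D.X t y + Torus.gradient (D.zeta t) y)
  rw [show D.w' t y = D.wpc t y + D.X t y from rfl]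
  abel

/-- **`w` is jointly smooth on `ℝ × 𝕋³`.** [cite: LuoTiti2020, §3.3] -/
theorem smooth_w : Torus.IsSmoothSpaceTimeOn univ S.w :=
  (Torus.isSmoothSpaceTimeOn_univ_cutoff (Datum.smooth_wpc h.hD) h.hψ h.hψsupp).add
    (Torus.isSmoothSpaceTimeOn_univ_cutoff (smooth_wt h) (timeFactor_pow h 2 two_ne_zero).1 (timeFactor_pow h 2 two_ne_zero).2)

/-- `wloc` is jointly smooth on `ℝ × 𝕋³`. [folklore] -/
theorem smooth_wloc : Torus.IsSmoothSpaceTimeOn univ S.wloc :=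
  (Torus.isSmoothSpaceTimeOn_univ_cutoff (Datum.smooth_wpc h.hD) h.hψ h.hψsupp).add
    (Torus.isSmoothSpaceTimeOn_univ_cutoff (Datum.smooth_X h.hD) (timeFactor_pow h 2 two_ne_zero).1 (timeFactor_pow h 2 two_ne_zero).2)

/-- `Z = ψ²ζ` is jointly smooth on `ℝ × 𝕋³`. [folklore] -/
theorem smooth_Z : Torus.IsSmoothSpaceTimeOn univ S.Z := by
  have := Torus.isSmoothSpaceTimeOn_univ_cutoff (Datum.smooth_zeta h.hD) (timeFactor_pow h 2 two_ne_zero).1 (timeFactor_pow h 2 two_ne_zero).2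
  simp only [smul_eq_mul] at this
  exact this

/-- `w = wloc + ∇Z`. [folklore] -/
theorem w_eq_wloc_add_gradient_Z (t : ℝ) (y : 𝕋³) : S.w t y = S.wloc t y + Torus.gradient (S.Z t) y := by
  by_cases ht : t ∈ tsupport S.ψ
  · have htI : t ∈ Icc 0 S.D.T := tsupport_subset_Icc h ht
    have hζs : Torus.IsSmooth (S.D.zeta t) := (Datum.smooth_zeta h.hD).isSmooth_slice htI
    have hζ : S.Z t = ((S.ψ t) ^ 2) • S.D.zeta t := by funext z; simp [Z, smul_eq_mul]
    rw [hζ, Torus.gradient_const_smul (hζs.isContDiff (by simp)) ((S.ψ t) ^ 2) y]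
    simp only [w, wloc, wt, smul_add]
    abel
  · have h0 : S.ψ t = 0 := Torus.apply_eq_zero_of_not_mem_tsupport ht
    have hZ : S.Z t = fun _ => (0 : ℝ) := by funext z; simp [Z, h0]
    rw [hZ, Torus.gradient_zero]
    simp [w, wloc, h0]

/-- `Rc` is jointly smooth on the slab and symmetric. [folklore] -/
theorem smooth_Rc : Torus.IsSmoothSpaceTimeOn (Icc 0 S.D.T) (Rc S.D) :=
  Torus.isSmoothSpaceTimeOn_tensor_iff.2 fun _ => (h.hD.hM.tensorTrace.div_const _).smul (Torus.isSmoothSpaceTimeOn_const (Torus.isSmooth_const _) _)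

omit h in
/-- `Rc` is symmetric (a multiple of the identity). [folklore] -/
theorem Rc_symm (D : JetStep.Datum) (t : ℝ) (y : 𝕋³) (i j : Fin 3) : Rc D t y i j = Rc D t y j i := by
  by_cases hij : i = j
  · subst hij; rfl
  · simp [Rc, hij, Ne.symm hij]

omit h in
/-- `Rc + R̊ = R`. [folklore] -/
theorem Rc_add_traceless (D : JetStep.Datum) (t : ℝ) (y : 𝕋³) (j : Fin 3) :
    Rc D t y j + Torus.traceless (D.M t) y j = D.M t y j := by
  simp only [Rc, Torus.traceless_apply, Fintype.card_fin, Nat.cast_ofNat]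
  abel

/-- **`S_ψ` is jointly smooth on `ℝ × 𝕋³`.** [folklore] -/
theorem smooth_Sψ : Torus.IsSmoothSpaceTimeOn univ S.Sψ := by
  have hD := h.hD
  have h1 : Torus.IsSmoothSpaceTimeOn (Icc 0 S.D.T) (fun t y j => S.D.cross t y j + S.D.Sosc t y j) :=
    (Datum.smooth_cross hD).add (Datum.smooth_Sosc hD)
  have hwpc := Datum.smooth_wpc hD
  have hwt := smooth_wt h
  have h2 : Torus.IsSmoothSpaceTimeOn (Icc 0 S.D.T) (fun t y j => Torus.tensorProd (S.D.wpc t) (wt S.D t) y j + Torus.tensorProd (wt S.D t) (S.D.wpc t) y j) :=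
    (hwpc.tensorProd hwt).add (hwt.tensorProd hwpc)
  have h3 : Torus.IsSmoothSpaceTimeOn (Icc 0 S.D.T) (fun t => Torus.tensorProd (wt S.D t) (wt S.D t)) := hwt.tensorProd hwt
  obtain ⟨c2, s2⟩ := timeFactor_pow h 2 two_ne_zero
  obtain ⟨c32, s32⟩ := timeFactor_pow_sub_pow h 3 2 three_ne_zero two_ne_zero
  obtain ⟨c42, s42⟩ := timeFactor_pow_sub_pow h 4 2 four_ne_zero two_ne_zero
  exact ((Torus.isSmoothSpaceTimeOn_univ_cutoff h1 c2 s2).add (Torus.isSmoothSpaceTimeOn_univ_cutoff h2 c32 s32)).add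
    (Torus.isSmoothSpaceTimeOn_univ_cutoff h3 c42 s42)

/-- **`q_ψ` is jointly smooth on `ℝ × 𝕋³`.** [folklore] -/
theorem smooth_qψ : Torus.IsSmoothSpaceTimeOn univ S.qψ := by
  have hD := h.hD
  have h1 : Torus.IsSmoothSpaceTimeOn (Icc 0 S.D.T) (fun t y => S.D.qfun t y + Torus.tensorTrace (S.D.M t) y / 3) :=
    (Datum.smooth_qfun hD).add (hD.hM.tensorTrace.div_const _)
  obtain ⟨c2, s2⟩ := timeFactor_pow h 2 two_ne_zero
  obtain ⟨-, cd, sd⟩ := timeFactor_deriv h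
  have a := Torus.isSmoothSpaceTimeOn_univ_cutoff h1 c2 s2
  have b := Torus.isSmoothSpaceTimeOn_univ_cutoff (Datum.smooth_zeta hD) cd sd
  have e : S.qψ = fun t y => (S.ψ t) ^ 2 • (S.D.qfun t y + Torus.tensorTrace (S.D.M t) y / 3) + (2 * S.ψ t * deriv S.ψ t) • S.D.zeta t y := by
    funext t y; simp [qψ, smul_eq_mul]
  rw [e]
  exact a.add b

/-- **`f_ψ` is jointly smooth on `ℝ × 𝕋³`.** [folklore] -/
theorem smooth_fψ : Torus.IsSmoothSpaceTimeOn univ S.fψ := by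
  have hD := h.hD
  obtain ⟨c2, s2⟩ := timeFactor_pow h 2 two_ne_zero
  obtain ⟨⟨cd1, sd1⟩, cd, sd⟩ := timeFactor_deriv h
  obtain ⟨c12, s12⟩ := timeFactor_pow_sub_pow h 1 2 one_ne_zero two_ne_zero
  have a := Torus.isSmoothSpaceTimeOn_univ_cutoff (Datum.smooth_ffun hD) c2 s2
  have b := Torus.isSmoothSpaceTimeOn_univ_cutoff (Datum.smooth_wpc hD) cd1 sd1
  have c := Torus.isSmoothSpaceTimeOn_univ_cutoff ((Datum.smooth_wpc hD).timeDerivWithin (Datum.uniqueDiffOn hD)) c12 s12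
  have d' := Torus.isSmoothSpaceTimeOn_univ_cutoff (Datum.smooth_X hD) cd sd
  have e : S.fψ = fun t y => (S.ψ t) ^ 2 • S.D.ffun t y + deriv S.ψ t • S.D.wpc t y +
      ((S.ψ t) ^ 1 - (S.ψ t) ^ 2) • Torus.timeDerivWithin (Icc 0 S.D.T) S.D.wpc t y + (2 * S.ψ t * deriv S.ψ t) • S.D.X t y := by
    funext t y; simp [fψ]
  rw [e]
  exact ((a.add b).add c).add d'

/-! ### Temporal support -/

omit h in
/-- Off `tsupport ψ`: `ψ = ψ′ = 0`. [folklore] -/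
theorem ψ_eq_zero {t : ℝ} (ht : t ∉ tsupport S.ψ) : S.ψ t = 0 ∧ deriv S.ψ t = 0 :=
  ⟨Torus.apply_eq_zero_of_not_mem_tsupport ht, Torus.deriv_eq_zero_of_not_mem_tsupport ht⟩

/-- Off `tsupport ψ` the stress vanishes: `R(t) = 0` (since `ψ(t) = 0 ≠ 1`). [folklore] -/
theorem M_eq_zero {t : ℝ} (ht : t ∉ tsupport S.ψ) : S.D.M t = 0 := by
  rcases h.hψM t with h1 | h0
  · exact absurd h1 (by rw [(ψ_eq_zero ht).1]; norm_num)
  · exact h0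

omit h in
/-- Off `tsupport ψ` everything vanishes: `w`, `wloc`, `Z`, `S_ψ`, `q_ψ`, `f_ψ`. [cite: LuoTiti2020, §3.4 (3.13)] -/
theorem eq_zero_of_not_mem {t : ℝ} (ht : t ∉ tsupport S.ψ) :
    S.w t = 0 ∧ S.wloc t = 0 ∧ S.Z t = 0 ∧ S.Sψ t = 0 ∧ S.qψ t = 0 ∧ S.fψ t = 0 := by
  obtain ⟨h0, h0'⟩ := ψ_eq_zero ht
  refine ⟨?_, ?_, ?_, ?_, ?_, ?_⟩
  · funext y; simp [w, h0]
  · funext y; simp [wloc, h0]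
  · funext y; simp [Z, h0]
  · funext y j; simp [Sψ, h0]
  · funext y; simp [qψ, h0]
  · funext y; simp [fψ, h0, h0']

omit h in
/-- The temporal support of `w` lies in `tsupport ψ`. [cite: LuoTiti2020, §3.4 (3.13)] -/
theorem support_w_subset : Function.support S.w ⊆ tsupport S.ψ := fun t ht => by
  by_contra hn
  exact ht (eq_zero_of_not_mem hn).1

/-! ### Divergence and mean -/

/-- `div wt = 0` on the slab (`div X = -G`, `Δζ = G`). [cite: BuckmasterVicol2020, §7.5.3 (7.37)] -/
theorem divergence_wt {t : ℝ} (ht : t ∈ Icc 0 S.D.T) (y : 𝕋³) : Torus.divergence (wt S.D t) y = 0 := by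
  have hD := h.hD
  have hX : Torus.IsSmooth (S.D.X t) := (Datum.smooth_X hD).isSmooth_slice ht
  have hζ : Torus.IsSmooth (S.D.zeta t) := (Datum.smooth_zeta hD).isSmooth_slice ht
  show Torus.divergence (fun y => S.D.X t y + Torus.gradient (S.D.zeta t) y) y = 0
  rw [Torus.divergence_add' hX hζ.gradient, Torus.divergence_gradient' hζ, Datum.laplacian_zeta hD ht, Datum.divergence_X hD ht]
  ring

/-- **`div w = 0`** at every time. [cite: LuoTiti2020, §3.3] -/
theorem isDivFree_w (t : ℝ) : Torus.IsDivFree (S.w t) := by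
  have hD := h.hD
  intro y
  by_cases ht : t ∈ tsupport S.ψ
  · have htI : t ∈ Icc 0 S.D.T := tsupport_subset_Icc h ht
    have hwpc : Torus.IsSmooth (S.D.wpc t) := (Datum.smooth_wpc hD).isSmooth_slice htI
    have hwt : Torus.IsSmooth (wt S.D t) := (smooth_wt h).isSmooth_slice htI
    have e : S.w t = fun z => ((S.ψ t) • S.D.wpc t) z + (((S.ψ t) ^ 2) • wt S.D t) z := by funext z; rfl
    have s1 : Torus.IsSmooth ((S.ψ t) • S.D.wpc t) := hwpc.smul _
    have s2 : Torus.IsSmooth (((S.ψ t) ^ 2) • wt S.D t) := hwt.smul _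
    rw [e, Torus.divergence_add' s1 s2, Torus.divergence_const_smul (hwpc.isContDiff (by simp)),
      Torus.divergence_const_smul (hwt.isContDiff (by simp)), Datum.divergence_wpc hD htI, divergence_wt h htI]
    simp
  · rw [(eq_zero_of_not_mem ht).1]
    simp [Torus.divergence, FunctionSpaces.Torus.partialDeriv, FunctionSpaces.Torus.lineDeriv]

/-- `∫ wt = 0` on the slab. [folklore] -/
theorem integral_wt {t : ℝ} (ht : t ∈ Icc 0 S.D.T) : ∫ y, wt S.D t y = 0 := by
  have hD := h.hD
  have hw := Datum.hasZeroMean_w hD ht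
  have hwpc : Torus.IsSmooth (S.D.wpc t) := (Datum.smooth_wpc hD).isSmooth_slice ht
  have hwt : Torus.IsSmooth (wt S.D t) := (smooth_wt h).isSmooth_slice ht
  have e : S.D.w t = fun y => S.D.wpc t y + wt S.D t y := funext (w_D_eq S.D t)
  unfold Torus.HasZeroMean at hw
  rw [e, integral_add hwpc.integrable hwt.integrable, Datum.integral_wpc hD ht, zero_add] at hw
  exact hw

/-- **`∫ w = 0`** at every time. [cite: LuoTiti2020, §3.5 ("Hence `∫ w_{q+1} dx = 0`")] -/
theorem integral_w (t : ℝ) : ∫ y, S.w t y = 0 := by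
  have hD := h.hD
  by_cases ht : t ∈ tsupport S.ψ
  · have htI : t ∈ Icc 0 S.D.T := tsupport_subset_Icc h ht
    have hwpc : Torus.IsSmooth (S.D.wpc t) := (Datum.smooth_wpc hD).isSmooth_slice htI
    have hwt : Torus.IsSmooth (wt S.D t) := (smooth_wt h).isSmooth_slice htI
    have i1 : Integrable (fun y => S.ψ t • S.D.wpc t y) volume := hwpc.integrable.smul (S.ψ t)
    have i2 : Integrable (fun y => (S.ψ t) ^ 2 • wt S.D t y) volume := hwt.integrable.smul ((S.ψ t) ^ 2)
    show ∫ y, (S.ψ t • S.D.wpc t y + (S.ψ t) ^ 2 • wt S.D t y) = 0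
    rw [integral_add i1 i2, integral_smul, integral_smul,
      Datum.integral_wpc hD htI, integral_wt h htI, smul_zero, smul_zero, add_zero]
  · rw [(eq_zero_of_not_mem ht).1]
    simp

/-! ### Time derivative -/

/-- **The time derivative of `w` inside the slab**:
`∂ₜw = ψ′ wpc + ψ ∂ₜwpc + 2ψψ′ wt + ψ² ∂ₜwt` (slab derivatives). [folklore] -/
theorem timeDeriv_w_of_mem {t : ℝ} (ht : t ∈ Ioo 0 S.D.T) (y : 𝕋³) :
    Torus.timeDeriv S.w t y = deriv S.ψ t • S.D.wpc t y + S.ψ t • Torus.timeDerivWithin (Icc 0 S.D.T) S.D.wpc t y +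
      (2 * S.ψ t * deriv S.ψ t) • wt S.D t y + (S.ψ t) ^ 2 • Torus.timeDerivWithin (Icc 0 S.D.T) (wt S.D) t y := by
  have hD := h.hD
  have h1 := Torus.hasDerivAt_cutoff_of_mem (Datum.smooth_wpc hD) h.hψ ht y
  have h2 := Torus.hasDerivAt_cutoff_of_mem (smooth_wt h) (h.hψ.pow 2) ht y
  have hsum := h1.add h2
  have hd2 : deriv (fun s => (S.ψ s) ^ 2) t = 2 * S.ψ t * deriv S.ψ t := by
    have hψ' := ((h.hψ.differentiable (by simp)).differentiableAt (x := t)).hasDerivAt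
    have h2 : HasDerivAt (fun s => (S.ψ s) ^ 2) (((2 : ℕ) : ℝ) * S.ψ t ^ (2 - 1) * deriv S.ψ t) t := hψ'.pow 2
    rw [h2.deriv]
    norm_num
  unfold Torus.timeDeriv
  change deriv ((fun s => S.ψ s • S.D.wpc s y) + fun s => (S.ψ s) ^ 2 • wt S.D s y) t = _
  rw [hsum.deriv, hd2]
  abel

/-- The slab derivative of `wt`: `∂ₜwt = ∂ₜX + ∇ζdot`. [folklore] -/
theorem timeDerivWithin_wt {t : ℝ} (ht : t ∈ Icc 0 S.D.T) (y : 𝕋³) :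
    Torus.timeDerivWithin (Icc 0 S.D.T) (wt S.D) t y = Torus.timeDerivWithin (Icc 0 S.D.T) S.D.X t y + Torus.gradient (S.D.zetadot t) y := by
  have hD := h.hD
  have hU := Datum.uniqueDiffOn hD
  have e : wt S.D = fun s z => S.D.X s z + Torus.gradient (S.D.zeta s) z := rfl
  rw [e, Torus.timeDerivWithin_add (Datum.smooth_X hD) ((Datum.smooth_zeta hD).gradient hU) hU ht,
    Datum.timeDerivWithin_gradient_comm hD.hT (Datum.smooth_zeta hD) ht]
  rfl

end Setup

end LuoTiti

end Literature.Analysis.FluidPDE
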